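import Summits.BirchSwinnertonDyer.Rank1Residual.X5.SelmerSolitaire
import Summits.BirchSwinnertonDyer.Rank1Residual.X5.SelmerSolitairePivotAux
import Summits.BirchSwinnertonDyer.Rank1Residual.X5.SelmerSolitaireAlternating
import HarnessLib

/-!
# O1 · stub₂″ `PivotRebase` PROVED: principal pivoting at a core vertex re-bases the Selmer solitaire

Cell `b2b-bsdres`, O1 (p = 2) PROVER ORDER v2.8 (ii′) (o1 PLAN §16), first item of lens-2's suggested
order "PivotRebase (S) → OnePrimeConnection (M−) → Bad1ThreePrimeConnection" (ROUTES-O1 §lens-2 G5.10).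
Pure 𝔽₂ linear algebra; reach-neutral (R1 closes no class by itself); nothing booked; no mark; O1 OPEN.
HONEST FRAMING (cell, verbatim): research route; theorems only below (the vocabulary is
`X5/SelmerSolitaire.lean`, the principal pivot transform is `X5/SelmerSolitairePivotAux.lean`).

* `pivotRebase_holds : PivotRebase` — for every position `P` (a simple graph on `D ⊔ {∞}` as a
  symmetric zero-diagonal `𝔽₂`-matrix `Ŝ`) and every core vertex `X` (`det Ŝ[X⁺] = 1`), the principal
  pivot transform `Ŝ ∗ X⁺` (Tucker 1960; Bouchet 1988: the Δ-matroid of `Ŝ ∗ X⁺` is the translate by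
  `X⁺`) is again a position, and its core vertices are exactly the translates `n ∆ X` of the core
  vertices of `P`.  Ingredients: Tucker's theorem in determinant-free form
  (`det_submatrix_pivot_eq_zero_iff`: `(Ŝ ∗ A)[Y]` singular iff `Ŝ[Y ∆ A]` singular); over `𝔽₂`,
  `det = 1 ⟺ det ≠ 0`; `(n ∆ X)⁺ = n⁺ ∆ X⁺` (parity of `#(n ∆ X)`); and the alternating-matrix facts
  that make the pivot a position (x11b3-p2 GEN 5's `X5/SelmerSolitaireAlternating.lean`, consumed BY
  NAME: `Alt.dotProduct_mulVec_self_eq_zero` — `v ⬝ Ŝ v = 0` for symmetric zero-diagonal `Ŝ` in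
  characteristic `2` —, `Alt.nonsing_inv_apply_self_eq_zero` — the inverse of an invertible such `Ŝ`
  has zero diagonal —, `Alt.isSymm_nonsing_inv_of_isSymm`, `Alt.eq_one_iff_ne_zero`); the Schur
  complement's diagonal vanishes by the first of these.

References: A. W. Tucker (1960); A. Bouchet, *Representability of Δ-matroids*, Colloq. Math. Soc.
János Bolyai 52 (1988) §3; M. J. Tsatsomeros, LAA 307 (2000) Thm. 3.1; lens-2 GEN 5 G5.10.
[cite: Tsatsomeros2000, Thm. 3.1] [cite: MazurRubin2004, §4.3]
-/

namespace Summit.BirchSwinnertonDyer.Rank1Residual.X5.SelmerSolitaire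

open Finset Matrix

/-! ## `n⁺` and symmetric differences -/

section Plus

variable {s : ℕ}

/-- `∞ ∈ n⁺ ⟺ |n|` is odd. [folklore] -/
theorem none_mem_plus_iff (n : Finset (Fin s)) : (none : V s) ∈ plus n ↔ ¬ Even n.card := by
  unfold plus
  split_ifs with h
  · simp [h]
  · simp [h]

/-- `q_i ∈ n⁺ ⟺ i ∈ n`. [folklore] -/
theorem some_mem_plus_iff (n : Finset (Fin s)) (i : Fin s) : (some i : V s) ∈ plus n ↔ i ∈ n := by
  unfold plus
  split_ifs with h
  · simp
  · simp

/-- Cardinality is additive mod `2` under symmetric difference. [folklore] -/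
theorem even_card_symmDiff_iff (n m : Finset (Fin s)) :
    Even (symmDiff n m).card ↔ (Even n.card ↔ Even m.card) := by
  have h1 : symmDiff n m = (n \ m) ∪ (m \ n) := rfl
  have hdisj : Disjoint (n \ m) (m \ n) :=
    Finset.disjoint_left.2 fun x hx hx' => (Finset.mem_sdiff.1 hx').2 (Finset.mem_sdiff.1 hx).1
  rw [h1, Finset.card_union_of_disjoint hdisj]
  have hA := Finset.card_sdiff_add_card_inter n m
  have hB := Finset.card_sdiff_add_card_inter m n
  rw [Finset.inter_comm] at hB
  rw [Nat.even_add, ← hA, ← hB, Nat.even_add, Nat.even_add]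
  tauto

/-- **`(n ∆ X)⁺ = n⁺ ∆ X⁺`.** [folklore] -/
theorem plus_symmDiff (n X : Finset (Fin s)) : plus (symmDiff n X) = symmDiff (plus n) (plus X) := by
  ext v
  rw [Finset.mem_symmDiff]
  cases v with
  | none =>
    rw [none_mem_plus_iff, none_mem_plus_iff, none_mem_plus_iff, even_card_symmDiff_iff]
    tauto
  | some i =>
    rw [some_mem_plus_iff, some_mem_plus_iff, some_mem_plus_iff, Finset.mem_symmDiff]

end Plus

/-! ## The pivot of a position at a core vertex is a position -/

section PivotPosition

variable {s : ℕ}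

/-- Principal minors along equal index sets agree (transport along `Y = Y'`). [folklore] -/
theorem det_submatrix_congr {ι : Type*} [DecidableEq ι] {R : Type*} [CommRing R] (M : Matrix ι ι R)
    {Y Y' : Finset ι} (h : Y = Y') :
    (M.submatrix (fun x : ↥Y => (x : ι)) (fun x : ↥Y => (x : ι))).det =
      (M.submatrix (fun x : ↥Y' => (x : ι)) (fun x : ↥Y' => (x : ι))).det := by
  subst h
  rfl

/-- The pivot of a position's matrix at a core vertex is symmetric. [cite: Tsatsomeros2000, Thm. 3.1] -/
theorem pivot_isSymm (P : Position s) (A : Finset (V s)) : (pivot P.S A).IsSymm := by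
  classical
  have hsub : (P.S.submatrix (Subtype.val : ↥A → V s) (Subtype.val : ↥A → V s)).IsSymm := by
    ext a b
    simp only [Matrix.transpose_apply, Matrix.submatrix_apply]
    exact P.symm.apply _ _
  have hTs : ∀ a b : ↥A, (P.S.submatrix (Subtype.val : ↥A → V s) (Subtype.val : ↥A → V s))⁻¹ a b =
      (P.S.submatrix (Subtype.val : ↥A → V s) (Subtype.val : ↥A → V s))⁻¹ b a := fun a b =>
    ((Alt.isSymm_nonsing_inv_of_isSymm _ hsub).apply a b).symm
  have hSs : ∀ i j : V s, P.S i j = P.S j i := fun i j => (P.symm.apply i j).symm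
  ext i j
  simp only [Matrix.transpose_apply]
  by_cases hi : i ∈ A <;> by_cases hj : j ∈ A
  · simp only [pivot, hi, hj, dif_pos]
    exact hTs _ _
  · simp only [pivot, hi, hj, dif_pos, dif_neg, not_false_eq_true]
    rw [ZMod.neg_eq_self_mod_two]
    exact Finset.sum_congr rfl fun a _ => by rw [hTs a, hSs j]; ring
  · simp only [pivot, hi, hj, dif_pos, dif_neg, not_false_eq_true]
    rw [ZMod.neg_eq_self_mod_two]
    exact Finset.sum_congr rfl fun a _ => by rw [hTs _ a, hSs _ i]; ring
  · simp only [pivot, hi, hj, dif_neg, not_false_eq_true]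
    rw [hSs i j, Finset.sum_comm]
    congr 1
    exact Finset.sum_congr rfl fun a _ => Finset.sum_congr rfl fun b _ => by
      rw [hTs b a, hSs j (b : V s), hSs (a : V s) i]; ring

/-- The pivot of a position's matrix at a core vertex has zero diagonal (inverse and Schur complement
of an alternating matrix are alternating). [cite: Tsatsomeros2000, Thm. 3.1] -/
theorem pivot_apply_self (P : Position s) (A : Finset (V s))
    (hA : IsUnit (P.S.submatrix (Subtype.val : ↥A → V s) Subtype.val).det) (i : V s) :
    pivot P.S A i i = 0 := by
  classical
  set T := (P.S.submatrix (Subtype.val : ↥A → V s) (Subtype.val : ↥A → V s))⁻¹ with hT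
  have hsub : (P.S.submatrix (Subtype.val : ↥A → V s) (Subtype.val : ↥A → V s)).IsSymm := by
    ext a b
    simp only [Matrix.transpose_apply, Matrix.submatrix_apply]
    exact P.symm.apply _ _
  have hsubd : ∀ a : ↥A, (P.S.submatrix (Subtype.val : ↥A → V s) (Subtype.val : ↥A → V s)) a a = 0 :=
    fun a => P.loopless a
  have hTs : T.IsSymm := Alt.isSymm_nonsing_inv_of_isSymm _ hsub
  have hTd : ∀ a : ↥A, T a a = 0 := fun a => Alt.nonsing_inv_apply_self_eq_zero _ hsub hsubd hA a
  by_cases hi : i ∈ A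
  · simp only [pivot, hi, dif_pos]
    exact hTd ⟨i, hi⟩
  · simp only [pivot, hi, dif_neg, not_false_eq_true]
    rw [P.loopless i, zero_sub, neg_eq_zero]
    -- `∑_{a,b} S i a T a b S b i = r ⬝ T r` with `r a = S a i`
    have hSs : ∀ a : ↥A, P.S i a = P.S a i := fun a => (P.symm.apply i a).symm
    have key := Alt.dotProduct_mulVec_self_eq_zero T hTs hTd (fun a : ↥A => P.S a i)
    simp only [dotProduct, Matrix.mulVec, Finset.mul_sum] at key
    rw [← key]
    exact Finset.sum_congr rfl fun a _ => Finset.sum_congr rfl fun b _ => by rw [hSs a]; ring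

end PivotPosition

/-! ## stub₂″ `PivotRebase` -/

/-- **stub₂″ `PivotRebase` holds**: principal pivoting at a core vertex `X` re-bases the position —
the cores of the pivot `Ŝ ∗ X⁺` are the translates `n ∆ X` (Tucker 1960 / Bouchet 1988, principal pivot
transform of Δ-matroids over `𝔽₂`; in lens-2's Lagrangian model it is T3 at another base).  Proof:
`(Ŝ ∗ X⁺)[n⁺]` is singular iff `Ŝ[n⁺ ∆ X⁺] = Ŝ[(n ∆ X)⁺]` is (`det_submatrix_pivot_eq_zero_iff`,
`plus_symmDiff`), and over `𝔽₂` "`det = 1`" is "nonsingular". [cite: Tsatsomeros2000, Thm. 3.1]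
[cite: MazurRubin2004, §4.3] -/
theorem pivotRebase_holds : PivotRebase := by
  classical
  intro s P X hX
  have hA : IsUnit (P.S.submatrix (Subtype.val : ↥(plus X) → V s) Subtype.val).det := by
    have h1 : (P.S.submatrix (Subtype.val : ↥(plus X) → V s) Subtype.val).det = 1 := hX
    rw [h1]; exact isUnit_one
  refine ⟨⟨pivot P.S (plus X), pivot_isSymm P (plus X), pivot_apply_self P (plus X) hA⟩, fun n => ?_⟩
  show ((pivot P.S (plus X)).submatrix (Subtype.val : ↥(plus n) → V s) Subtype.val).det = 1 ↔
    (P.S.submatrix (fun x : ↥(plus (symmDiff n X)) => (x : V s))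
      (fun x : ↥(plus (symmDiff n X)) => (x : V s))).det = 1
  rw [det_submatrix_congr P.S (plus_symmDiff n X), Alt.eq_one_iff_ne_zero,
    Alt.eq_one_iff_ne_zero, Ne, det_submatrix_pivot_eq_zero_iff hA (plus n)]

end Summit.BirchSwinnertonDyer.Rank1Residual.X5.SelmerSolitaire
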